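import Summits.NavierStokesRegularity.NavierStokesRegularity.Theses.AdaptedFrequency
import Literature.Analysis.FluidPDE.PineauVicolBernoulli
import Literature.Analysis.FluidPDE.AdaptedBackwardKernel

/-!
# Sketch — crux-ideate `stmt-NavierStokesRegularity-2955` (FrequencyRigidity), ideator k = 1 (gen 2)
# idea `rotation-gauged-head`: first lemmas as `Prop`s over existing declarations (elaboration only).

Conventions are those of `Literature.Analysis.FluidPDE.PineauVicol2026.bernoulli_identity_rdss`
(Pineau–Vicol 2026 (1.14a), `ν = 1`, `a = ½`, `J = rotGen = e₃ × ·`):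
`U_s + α(JU − DU(Jy)) + ½U + ½DU(y) − ΔU + (U·∇)U + ∇P = 0`, `div U = 0`, `ΔP = −tr((∇U)²)`.
-/

noncomputable section

namespace Summit.NavierStokesRegularity.NavierStokesRegularity.Cruxes.FrequencyRigidity.RotationGaugedHead

open Literature.Analysis.FluidPDE MeasureTheory
open scoped RealInnerProductSpace Laplacian ContDiff

/-- Physical / similarity space `ℝ³`. -/
abbrev E3 := EuclideanSpace ℝ (Fin 3)

/-- The rotation axis `e₃ = (0,0,1)`; `rotGen v = e₃ × v`. -/
def e₃ : E3 := EuclideanSpace.single 2 1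

/-- Angular-momentum density about the `e₃`-axis (the Noether charge density of rotations;
KNSS's swirl `r u_θ`): `ℓ(y) = ⟪J y, U y⟫ = y₀U₁ − y₁U₀`. -/
def angMom (U : E3 → E3) (y : E3) : ℝ := ⟪rotGen y, U y⟫

/-- The ROTATION-GAUGED HEAD `Π_α = P + ½|U|² + ½ y·U − α ⟪Jy, U⟫` (Tsai's head pressure minus
`α` times the angular-momentum density). -/
def rotHead (α : ℝ) (U : E3 → E3) (P : E3 → ℝ) (y : E3) : ℝ :=
  headPressure (1 / 2) U P y - α * angMom U y

/-- Drift operator with the CO-ROTATING drift `b_α = U + ½y − αJy`: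
`L_α f = Δf − Df[U + ½ y − α J y] = driftOp 1 ½ U f + α Df[Jy]`. -/
def rotDriftOp (α : ℝ) (U : E3 → E3) (f : E3 → ℝ) (y : E3) : ℝ :=
  driftOp 1 (1 / 2) U f y + α * fderiv ℝ f y (rotGen y)

/-- The rotated time-dependent profile system (1.14a) on one slice, pointwise, with `Us = ∂ₛU`. -/
def ProfileEq (α : ℝ) (U Us : E3 → E3) (P : E3 → ℝ) : Prop :=
  ∀ y, Us y + α • (rotGen (U y) - fderiv ℝ U y (rotGen y)) + (1 / 2 : ℝ) • U y +
    (1 / 2 : ℝ) • fderiv ℝ U y y - (Δ U) y + convect U U y + gradient P y = 0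

/-- Pressure Poisson equation in trace form `ΔP = −tr((∇U)²)` (as in `bernoulli_identity_rdss`). -/
def PoissonEq (U : E3 → E3) (P : E3 → ℝ) : Prop :=
  ∀ y, ∑ l, pderiv l (pderiv l P) y =
    -∑ l, ∑ j, pderiv l (fun z => U z j) y * pderiv j (fun z => U z l) y

/-- **First lemma 1 — TORQUE LAW (pointwise angular-momentum law, NO Poisson equation needed).**
For every slice of the rotated profile system, the angular-momentum density obeys
`Δℓ − Dℓ[U + ½y] = ⟪Jy, ∇P⟫ + ⟪Jy, F⟫ + 2 Ω₃`, `F = Us + α(JU − DU(Jy))`, `Ω = curl U`: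
the pressure enters ONLY through its angular derivative `∂_φ P = ⟪Jy, ∇P⟫`. [size S–M: product
rule for `Δ⟪Jy, U⟫ = ⟪Jy, ΔU⟫ + 2Ω₃`, the system, and `⟪U, J(U + ½y)⟫ = ½ℓ`; sympy-checked, kit j009525] -/
def TorqueLaw : Prop :=
  ∀ (α : ℝ) (U Us : E3 → E3) (P : E3 → ℝ), ContDiff ℝ ∞ U → ContDiff ℝ ∞ P →
    ProfileEq α U Us P → VectorCalculus.IsDivFree U →
    ∀ y, driftOp 1 (1 / 2) U (angMom U) y =
      ⟪rotGen y, gradient P y⟫ + ⟪rotGen y, Us y + α • (rotGen (U y) - fderiv ℝ U y (rotGen y))⟫ +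
        2 * (curl U y) 2

/-- **First lemma 2 — ROTATING BERNOULLI IDENTITY (pointwise).** Combining the torque law with
Pineau–Vicol's (7.7) (`bernoulli_identity_rdss`): the rotation-gauged head satisfies, for the
co-rotating drift operator,
`L_α Π_α = |Ω|² − 2αΩ₃ + ⟪U + ½y − αJy, Us⟫ = |Ω − αe₃|² − α² + ⟪b_α, Us⟫`.
On a rotating wave (`Us = 0`, RSS) the right side is SIGN-DEFINITE UP TO THE CONSTANT `α²` — the
`α`-modified Bernoulli quantity Pineau–Vicol (arXiv:2607.09619, p. 4) report as unknown. -/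
def RotatingBernoulliIdentity : Prop :=
  ∀ (α : ℝ) (U Us : E3 → E3) (P : E3 → ℝ), ContDiff ℝ ∞ U → ContDiff ℝ ∞ P →
    ProfileEq α U Us P → VectorCalculus.IsDivFree U → PoissonEq U P →
    ∀ y, rotDriftOp α U (rotHead α U P) y =
      ‖curl U y‖ ^ 2 - 2 * α * (curl U y) 2 + ⟪U y + (1 / 2 : ℝ) • y - α • rotGen y, Us y⟫

/-- **First lemma 3 — RSS VARIANCE IDENTITY (kernel-paired).** For a bounded `C^∞` rotating-wave
profile (`Us = 0`) with bounded gradient and polynomially bounded pressure, and ANY positive `C²`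
weight `w` in the kernel of the adjoint `L_α* w = Δw + div(b_α w) = Δw + Dw[b_α] + (3/2)w = 0`
(the co-rotating adapted kernel = the crux's `K` read in the rotating similarity frame; Pineau–Vicol
Prop. 5.1 / Remark 5.2 with the skew drift `−αJy` added) with unit mass and Gaussian bounds on
`w, ∇w`: `∫ |curl U − α e₃|² w dy = α²`. Consequences: kernel-variance of the vorticity `≤ α²`,
kernel-mean vorticity `m` in the closed ball `B̄(αe₃, |α|)`, kernel enstrophy `= 2α m₃ ≤ 4α²`
(independent of the Type-I constant); `α = 0` is Tsai `q = ∞` in one line. -/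
def RSSVarianceIdentity : Prop :=
  ∀ (α C : ℝ) (N : ℕ) (U : E3 → E3) (P : E3 → ℝ) (w : E3 → ℝ),
    ContDiff ℝ ∞ U → ContDiff ℝ ∞ P → ProfileEq α U (fun _ => 0) P →
    VectorCalculus.IsDivFree U → PoissonEq U P →
    (∀ y, ‖U y‖ ≤ C) → (∀ y, ‖fderiv ℝ U y‖ ≤ C) → (∀ y, ‖fderiv ℝ (fderiv ℝ U) y‖ ≤ C) →
    (∀ y, |P y| ≤ C * (1 + ‖y‖) ^ N) →
    ContDiff ℝ 2 w → (∀ y, 0 < w y) →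
    (∀ y, (Δ w) y + fderiv ℝ w y (U y + (1 / 2 : ℝ) • y - α • rotGen y) + (3 / 2 : ℝ) * w y = 0) →
    (∫ y, w y = 1) →
    (∃ M c : ℝ, 0 < c ∧ ∀ y, w y ≤ M * Real.exp (-c * ‖y‖ ^ 2) ∧
      ‖fderiv ℝ w y‖ ≤ M * Real.exp (-c * ‖y‖ ^ 2)) →
    ∫ y, ‖curl U y - α • e₃‖ ^ 2 * w y = α ^ 2

/-- **By-product — PARTIAL RSS-LIOUVILLE (vorticity avoiding the open co-rotation ball).** If the
vorticity of a bounded rotating-wave profile never enters the open ball `B(αe₃, |α|)` — i.e.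
`|Ω(y)|² ≥ 2α Ω₃(y)` for all `y` — then `Π_α` is a global subsolution of `L_α` with polynomial
growth, hence constant (Tsai's Liouville lemma `isConst_of_driftOp_nonneg_of_poly`, radial
barriers being blind to the skew drift `αJy`), hence `|Ω − αe₃| ≡ |α|` and `∇Π_α ≡ 0`, which reads
`ν curl Ω = (U + ½y − αJy) × Ω` (a force-free/Beltrami-type first integral); the claim is that this
forces `U ≡ 0` under the Type-I decay `|U| ≤ C/(1+|y|)`. -/
def RSSLiouvilleOffCorotationBall : Prop :=
  ∀ (α C : ℝ) (U : E3 → E3) (P : E3 → ℝ), ContDiff ℝ ∞ U → ContDiff ℝ ∞ P →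
    ProfileEq α U (fun _ => 0) P → VectorCalculus.IsDivFree U → PoissonEq U P →
    (∀ y, ‖U y‖ ≤ C / (1 + ‖y‖)) →
    (∀ y, 2 * α * (curl U y) 2 ≤ ‖curl U y‖ ^ 2) →
    U = 0

end Summit.NavierStokesRegularity.NavierStokesRegularity.Cruxes.FrequencyRigidity.RotationGaugedHead

end
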